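import Literature.AlgebraicGeometry.Resolution.AdicCompletionRegular
import Literature.AlgebraicGeometry.Resolution.AdicQuotient
import Literature.AlgebraicGeometry.Resolution.UnramifiedLocalHomDense
import Mathlib.RingTheory.KrullDimension.NonZeroDivisors
import HarnessLib

/-!
# Regularity descends along a dense local homomorphism from an analytically irreducible local ring ([CoP1] (45): "`R` is regular since `S′` is")

Topic: `Literature/AlgebraicGeometry/Resolution`. PROOF side of `CossartPiltant2019ReductionP`
(`ArithmeticalThreefoldsLocal.lean`), input (C4), decomposition layer of [CoP1] Prop. 9.3
(hypothesis `hDec` of `cossartPiltant2019ReductionP_of_cjs_of_stableInertiaHensel`). The last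
sentence of the printed proof (HAL p. 28) is "Now, `R` is regular since `S′` is by (45)", where

> (45) … `R′` is local-étale over `R` by [40], theorem 2 on p.110, so that
> `R is regular ⇔ R′ is regular`

([40] = Raynaud, *Anneaux locaux henséliens*: the model `R′ ⊂ Rʰ` of `K′ ⊆ Kˢ` above a normal
local model `R` dominating `R₀` lies in the henselization). We replace the appeal to the
henselization by completion: by `SplittingRingUnramified.lean` the local homomorphism `R → R′`
is UNRAMIFIED (`𝔪_R R′ = 𝔪_{R′}`) with TRIVIAL RESIDUE EXTENSION, hence `R` is `𝔪`-adically
dense in `R′` (`UnramifiedLocalHomDense.lean`); `R`, a normal local ring essentially of finite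
type over the excellent `S`, is analytically irreducible (`NormalAscentCompletion.lean`,
Zariski / Stacks 0C23); and `dim R = dim R′`. This file proves that under exactly these
hypotheses the completions agree and regularity descends:

* `adicCompletionMap_surjective_of_dense` — PROVED: for a local homomorphism `f : A → B` of
  Noetherian local rings with `𝔪_A B = 𝔪_B` and `A → B/𝔪_B` onto, the induced map `Â → B̂` is
  surjective (compatible lifts are built with `exists_sub_map_mem_pow_succ_of_mem_map_pow`);
* `adicCompletionMap_bijective_of_dense` — PROVED: if moreover `Â` is a domain and
  `dim A = dim B`, then `Â → B̂` is bijective (a surjection from a complete local domain onto a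
  ring of the same finite dimension: a non-zero kernel would drop the dimension,
  `ringKrullDim_succ_le_of_surjective`);
* `isRegularLocalRing_of_dense` — PROVED, **(45) in our architecture**: under these hypotheses,
  `B` regular ⟹ `A` regular (`Â ≅ B̂` is regular; regularity descends from the completion).

Everything is PROVED; no named facts, definitions, instances or notation are introduced.

## Sources

* V. Cossart, O. Piltant, J. Algebra 320 (2008) 1051–1082: proof of Prop. 9.3, (45) and last
  sentence (HAL hal-00139124, pp. 27–28). [CossartPiltant2008]
* H. Matsumura, *Commutative Ring Theory* (1986), Thm. 8.4, §19 p. 158 (proof of Thm. 19.5).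
  [Matsumura1987]
* M. Raynaud, *Anneaux locaux henséliens*, LNM 169 (1970), Ch. X Thm. 2 (as cited). [folklore]
-/

noncomputable section

open IsLocalRing AdicCompletion

namespace Literature.AlgebraicGeometry.Resolution

universe u

section Dense

variable {A B : Type u} [CommRing A] [CommRing B] [IsLocalRing A] [IsLocalRing B]
  (f : A →+* B) (hm : (maximalIdeal A).map f = maximalIdeal B)
  (hres : ∀ b : B, ∃ a : A, b - f a ∈ maximalIdeal B)

include hm hres

/-- **`Â → B̂` is onto for a dense local homomorphism.** For `f : A → B` with `𝔪_A B = 𝔪_B`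
and `A → B/𝔪_B` onto, every `𝔪_B`-adic Cauchy sequence `(bₙ)` lifts: there are `aₙ ∈ A` with
`f(aₙ) ≡ bₙ mod 𝔪_Bⁿ` and `aₙ₊₁ ≡ aₙ mod 𝔪_Aⁿ` (induction with
`exists_sub_map_mem_pow_succ_of_mem_map_pow`: `𝔪_Aⁿ B = f(𝔪_Aⁿ) + 𝔪_B^{n+1}`).
[cite: Matsumura1987, Thm. 8.4] [cite: CossartPiltant2008, proof of Prop. 9.3 (HAL p. 28), "`R₁` lies dense in `R₁′`"] -/
theorem adicCompletionMap_surjective_of_dense :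
    Function.Surjective (adicCompletionMap (maximalIdeal A) (maximalIdeal B) f hm.le) := by
  classical
  intro y
  obtain ⟨b, rfl⟩ := AdicCompletion.mk_surjective (maximalIdeal B) B y
  -- Cauchy condition of `b` in ideal form
  have hb : ∀ n, b (n + 1) - b n ∈ maximalIdeal B ^ n := by
    intro n
    have h := (b.property (Nat.le_succ n)).symm
    rw [SModEq.sub_mem, mem_pow_smul_top_iff] at h
    exact h
  have hpow : ∀ n, maximalIdeal B ^ n = (maximalIdeal A ^ n).map f := fun n => by
    rw [Ideal.map_pow, hm]
  -- the inductive step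
  have step : ∀ n, ∀ a : {a : A // b n - f a ∈ maximalIdeal B ^ n},
      ∃ a' : {a : A // b (n + 1) - f a ∈ maximalIdeal B ^ (n + 1)},
        (a' : A) - a ∈ maximalIdeal A ^ n := by
    intro n a
    have h1 : b (n + 1) - f a ∈ (maximalIdeal A ^ n).map f := by
      rw [← hpow]
      have : b (n + 1) - f a = (b (n + 1) - b n) + (b n - f a) := by ring
      rw [this]
      exact Ideal.add_mem _ (hb n) a.2
    obtain ⟨c, hc, hc'⟩ := exists_sub_map_mem_pow_succ_of_mem_map_pow f hm.le hres n h1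
    refine ⟨⟨a + c, ?_⟩, ?_⟩
    · have : b (n + 1) - f (a + c) = b (n + 1) - f a - f c := by rw [map_add]; ring
      rw [this]
      exact hc'
    · show (a : A) + c - a ∈ maximalIdeal A ^ n
      rw [add_sub_cancel_left]
      exact hc
  choose g hg using step
  let seq : ∀ n : ℕ, {a : A // b n - f a ∈ maximalIdeal B ^ n} := fun n =>
    Nat.rec (motive := fun n => {a : A // b n - f a ∈ maximalIdeal B ^ n})
      ⟨0, by rw [pow_zero, Ideal.one_eq_top]; exact Submodule.mem_top⟩ (fun n a => g n a) n
  have hseq : ∀ n, seq (n + 1) = g n (seq n) := fun n => rfl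
  -- the lifted Cauchy sequence
  let a : AdicCauchySequence (maximalIdeal A) A :=
    AdicCauchySequence.mk (I := maximalIdeal A) (M := A) (fun n => (seq n).1) (fun n => by
      rw [SModEq.sub_mem, mem_pow_smul_top_iff, ← Ideal.neg_mem_iff, neg_sub]
      change ((g n (seq n) : A)) - (seq n : A) ∈ maximalIdeal A ^ n
      exact hg n (seq n))
  refine ⟨AdicCompletion.mk (maximalIdeal A) A a, ?_⟩
  refine ext_evalₐ (fun n => ?_)
  rw [evalₐ_adicCompletionMap, evalₐ_mk, evalₐ_mk, Ideal.quotientMap_mk, Ideal.Quotient.eq,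
    ← Ideal.neg_mem_iff, neg_sub]
  exact (seq n).2

variable [IsNoetherianRing A] [IsNoetherianRing B]
  [IsDomain (AdicCompletion (maximalIdeal A) A)] (hdim : ringKrullDim A = ringKrullDim B)

include hdim

/-- **`Â ≅ B̂`.** If moreover `A`, `B` are Noetherian, `Â` is a domain and `dim A = dim B`,
the surjection `Â → B̂` is injective: a non-zero element of the kernel would be a
non-zero-divisor and force `dim B̂ + 1 ≤ dim Â` (`ringKrullDim_succ_le_of_surjective`), while
`dim Â = dim A = dim B = dim B̂` is finite.
[cite: CossartPiltant2008, proof of Prop. 9.3, (45) (HAL p. 27)] -/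
theorem adicCompletionMap_bijective_of_dense :
    Function.Bijective (adicCompletionMap (maximalIdeal A) (maximalIdeal B) f hm.le) := by
  set ψ := adicCompletionMap (maximalIdeal A) (maximalIdeal B) f hm.le
  have hsurj := adicCompletionMap_surjective_of_dense f hm hres
  refine ⟨?_, hsurj⟩
  rw [injective_iff_map_eq_zero]
  intro x hx
  by_contra hx0
  have hmem : x ∈ RingHom.ker ψ := hx
  have hnzd : x ∈ nonZeroDivisors (AdicCompletion (maximalIdeal A) A) :=
    mem_nonZeroDivisors_of_ne_zero hx0
  have hle := ringKrullDim_succ_le_of_surjective ψ hsurj hnzd hx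
  rw [ringKrullDim_adicCompletion, ringKrullDim_adicCompletion, ← hdim] at hle
  -- `dim A + 1 ≤ dim A` with `dim A` finite and `≠ ⊥`
  have hne : ringKrullDim A ≠ ⊤ := ringKrullDim_ne_top
  have hnb : ringKrullDim A ≠ ⊥ := ringKrullDim_ne_bot
  obtain ⟨e, he⟩ := WithBot.ne_bot_iff_exists.mp hnb
  rw [← he] at hle hne
  have hne' : e ≠ ⊤ := fun h => hne (by rw [h]; rfl)
  obtain ⟨n, rfl⟩ := ENat.ne_top_iff_exists.mp hne'
  have h3 : ¬ (((n : ℕ∞) : WithBot ℕ∞) + 1 ≤ ((n : ℕ∞) : WithBot ℕ∞)) := by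
    rw [← WithBot.coe_one, ← WithBot.coe_add, WithBot.coe_le_coe]
    norm_cast
    omega
  exact h3 hle

/-- **[CoP1] (45), completion form: regularity descends along a dense local homomorphism from
an analytically irreducible ring.** Let `f : A → B` be a local homomorphism of Noetherian local
rings with `𝔪_A B = 𝔪_B`, `A → B/𝔪_B` onto, `dim A = dim B`, `Â` a domain, and `B` regular.
Then `A` is regular: `Â ≅ B̂` (`adicCompletionMap_bijective_of_dense`), `B̂` is regular, and a
Noetherian local ring with regular completion is regular (same dimension and embedding
dimension). In [CoP1] Prop. 9.3: `A = R` (normal, excellent, hence analytically irreducible),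
`B = R′ = S′`, and "`R` is regular since `S′` is".
[cite: CossartPiltant2008, proof of Prop. 9.3, (45) and last sentence (HAL pp. 27–28)]
[cite: Matsumura1987, §19 p. 158 (proof of Thm. 19.5)] -/
theorem isRegularLocalRing_of_dense (hB : IsRegularLocalRing B) : IsRegularLocalRing A := by
  haveI := hB
  haveI : IsNoetherianRing (AdicCompletion (maximalIdeal A) A) :=
    isNoetherianRing_adicCompletion_maximalIdeal A
  have hbij := adicCompletionMap_bijective_of_dense f hm hres hdim
  let e : AdicCompletion (maximalIdeal A) A ≃+* AdicCompletion (maximalIdeal B) B :=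
    RingEquiv.ofBijective _ hbij
  haveI : IsRegularLocalRing (AdicCompletion (maximalIdeal B) B) :=
    isRegularLocalRing_adicCompletion B
  have hA : IsRegularLocalRing (AdicCompletion (maximalIdeal A) A) :=
    IsRegularLocalRing.of_ringEquiv e.symm
  refine IsRegularLocalRing.of_spanFinrank_maximalIdeal_le A (le_of_eq ?_)
  have h1 := hA.spanFinrank_maximalIdeal
  rwa [AdicCompletion.spanFinrank_maximalIdeal_eq, ringKrullDim_adicCompletion] at h1

end Dense

end Literature.AlgebraicGeometry.Resolution

end
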